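import Mathlib
import Literature.Analysis.ODE.InverseSquareLadderAsymptotics

/-!
# The Darboux ladder on monomials: `ladder ι n (x^i) = γₙ(i) x^{i−n}`, and ladders of polynomials
# of degree `≤ n` are combinations of the EVEN inverse powers `x^{2k−n}`

Analysis/ODE support file (everything proved, no definitions). For the ladder
`ladder ι n = (∂ − nι)∘⋯∘(∂ − ι)` of `InverseSquareLadder.lean` with `ι = 1/x` on `[½, ∞)`:
* `ladder_pow_eq` : for `i : ℕ` and `x > ½`,
  `ladder ι n (y ↦ y^i) x = (∏_{k<n} (i − 2k − 1)) · x^{(i:ℤ) − n}`; the prefactor vanishes for odd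
  `i < 2n` (`ladderCoeff_eq_zero_of_odd`), i.e. the ladder kills `x, x³, …, x^{2n−1}` — its kernel;
* `exists_ladder_polynomial_eq` / `exists_ladder_taylorSum_eq` / `exists_ladder_taylorSum_lt_eq` :
  consequently the ladder of a polynomial of degree `< N ≤ n + 1` (e.g. a Taylor sum
  `y ↦ Σ_{m ≤ n} d_m (y − R)^m`, or one of degree `< n`) is, on `x > ½`, a combination
  `Σ_{k < (N+1)/2} α_k ι(x)^{n−2k}` of the even inverse powers only.
These combinations are exactly the Cauchy data of the `t`-polynomial (non-radiating) solutions of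
the exact inverse-square wave equation `ψ_tt − ψ_xx + n(n+1)x⁻²ψ = 0` on an exterior cone — the
kernel `P(R)` of the exterior channel estimate of Kenig–Lawrie–Liu–Schlag (2015, radial odd-dimensional
form): `x^{−n}, x^{2−n}, …` are `r^{2k−d}·r^{(d−1)/2}` for `d = 2n+3`. Used to identify the kernel
datum produced by the Taylor-polynomial normalisation in the exact channel estimate (route
PhotonSphereChannels, `FixedModeChannels`, far side, stmt-FinalStateConjecture-10048). Folklore.
-/

noncomputable section

namespace Literature.Analysis.ODE

open Set Filter Finset Polynomial
open scoped _root_.Topology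

variable {ι : ℝ → ℝ}

/-- **Ladder of a monomial.** For `ι = 1/x` on `[½,∞)`, `i : ℕ` and `x > ½`:
`ladder ι n (y ↦ y^i) x = (∏_{k<n} (i − 2k − 1)) x^{(i:ℤ)−n}`. [folklore] -/
theorem ladder_pow_eq (hιeq : ∀ x : ℝ, 1 / 2 ≤ x → ι x = x⁻¹) (i : ℕ) :
    ∀ n : ℕ, ∀ x : ℝ, 1 / 2 < x →
      ladder ι n (fun y : ℝ => y ^ i) x
        = (∏ k ∈ range n, ((i : ℝ) - 2 * k - 1)) * x ^ ((i : ℤ) - n) := by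
  intro n
  induction n with
  | zero =>
    intro x _
    simp [zpow_natCast]
  | succ n ih =>
    intro x hx
    have hx0 : x ≠ 0 := by intro h; rw [h] at hx; norm_num at hx
    rw [ladder_succ, ladderStep_apply]
    -- the level-`n` ladder agrees with the closed form near `x`
    have hev : ladder ι n (fun y : ℝ => y ^ i)
        =ᶠ[𝓝 x] fun y => (∏ k ∈ range n, ((i : ℝ) - 2 * k - 1)) * y ^ ((i : ℤ) - n) :=
      Filter.mem_of_superset (Ioi_mem_nhds hx) fun y hy => ih y hy
    rw [hev.deriv_eq, ih x hx, hιeq x hx.le]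
    have hd : deriv (fun y : ℝ => (∏ k ∈ range n, ((i : ℝ) - 2 * k - 1)) * y ^ ((i : ℤ) - n)) x
        = (∏ k ∈ range n, ((i : ℝ) - 2 * k - 1)) * ((((i : ℤ) - n : ℤ) : ℝ) * x ^ ((i : ℤ) - n - 1)) := by
      rw [deriv_const_mul_field, deriv_zpow]
    rw [hd, prod_range_succ]
    have hz1 : x ^ ((i : ℤ) - n) = x ^ ((i : ℤ) - (n + 1 : ℕ)) * x := by
      rw [← zpow_add_one₀ hx0]; congr 1; push_cast; ring
    have hz2 : x ^ ((i : ℤ) - n - 1) = x ^ ((i : ℤ) - (n + 1 : ℕ)) := by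
      congr 1; push_cast; ring
    rw [hz1, hz2]
    field_simp
    push_cast
    ring

/-- The prefactor `∏_{k<n} (i − 2k − 1)` vanishes for odd `i < 2n`: the ladder kills
`x, x³, …, x^{2n−1}`. [folklore] -/
theorem ladderCoeff_eq_zero_of_odd {i n : ℕ} (hi : Odd i) (hin : i < 2 * n) :
    (∏ k ∈ range n, ((i : ℝ) - 2 * k - 1)) = 0 := by
  obtain ⟨j, rfl⟩ := hi
  refine Finset.prod_eq_zero (i := j) (Finset.mem_range.2 (by omega)) ?_
  push_cast; ring

/-- For even `i = 2k ≤ n`: `x^{(i:ℤ) − n} = (x⁻¹)^{n − 2k}`. [folklore] -/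
theorem zpow_sub_eq_inv_pow (x : ℝ) {k n : ℕ} (hk : 2 * k ≤ n) :
    x ^ (((2 * k : ℕ) : ℤ) - n) = x⁻¹ ^ (n - 2 * k) := by
  rw [inv_pow, ← zpow_natCast, ← zpow_neg]
  congr 1
  push_cast [Nat.cast_sub hk]
  ring

/-- Ladders of finite sums (all summands `Cⁿ`). [folklore] -/
theorem ladder_finset_sum (hι : ContDiff ℝ (⊤ : ℕ∞) ι) {n : ℕ} {s : Finset ℕ} {f : ℕ → ℝ → ℝ}
    (hf : ∀ i ∈ s, ContDiff ℝ n (f i)) :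
    ladder ι n (fun y => ∑ i ∈ s, f i y) = fun x => ∑ i ∈ s, ladder ι n (f i) x := by
  classical
  induction s using Finset.induction_on with
  | empty =>
    funext x
    simp only [sum_empty]
    -- the ladder of the zero function is zero
    have : ladder ι n (fun _ : ℝ => (0 : ℝ)) = fun _ => 0 := by
      have h := ladder_const_mul (ι := ι) n (fun _ : ℝ => (0 : ℝ)) 0
      simpa using h
    exact congrFun this x
  | insert a s ha ih =>
    have hfa : ContDiff ℝ n (f a) := hf a (mem_insert_self a s)
    have hfs : ∀ i ∈ s, ContDiff ℝ n (f i) := fun i hi => hf i (mem_insert_of_mem hi)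
    have hsum : ContDiff ℝ n (fun y => ∑ i ∈ s, f i y) := ContDiff.sum fun i hi => hfs i hi
    funext x
    simp only [sum_insert ha]
    have h := ladder_add hι hfa hsum
    have h' : (ladder ι n fun y => f a y + ∑ i ∈ s, f i y)
        = fun x => ladder ι n (f a) x + ladder ι n (fun y => ∑ i ∈ s, f i y) x := h
    rw [show (fun y => f a y + ∑ i ∈ s, f i y) = (fun y => f a y + ∑ i ∈ s, f i y) from rfl] at h'
    have := congrFun h' x
    rw [show (fun y => f a y + ∑ i ∈ s, f i y) = fun y => f a y + ∑ i ∈ s, f i y from rfl]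
    rw [this, congrFun (ih hfs) x]

/-- Re-indexing a sum over `range N` whose odd terms vanish by the even indices `2k`,
`k < (N+1)/2`. [folklore] -/
theorem sum_range_eq_sum_even {M : Type*} [AddCommMonoid M] (N : ℕ) (f : ℕ → M)
    (hodd : ∀ i, Odd i → f i = 0) :
    ∑ i ∈ range N, f i = ∑ k ∈ range ((N + 1) / 2), f (2 * k) := by
  classical
  have h1 : ∑ i ∈ range N, f i = ∑ i ∈ (range N).filter Even, f i := by
    rw [sum_filter]
    refine sum_congr rfl fun i _ => ?_
    by_cases h : Even i
    · rw [if_pos h]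
    · rw [if_neg h, hodd i (Nat.not_even_iff_odd.1 h)]
  have h2 : (range N).filter Even = (range ((N + 1) / 2)).image (fun k => 2 * k) := by
    ext i
    simp only [Finset.mem_filter, Finset.mem_range, Finset.mem_image]
    constructor
    · rintro ⟨hi, ⟨k, rfl⟩⟩
      exact ⟨k, by omega, by omega⟩
    · rintro ⟨k, hk, rfl⟩
      exact ⟨by omega, ⟨k, by ring⟩⟩
  rw [h1, h2, sum_image]
  intro a _ b _ h
  simpa using h

/-- **Ladders of polynomials of degree `< N ≤ n + 1` are combinations of even inverse powers.**
For a polynomial `p` with `natDegree p < N`, `N ≤ n + 1`, and `ι = 1/x` on `[½,∞)` there are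
coefficients `α_k` with `ladder ι n (p.eval) x = Σ_{k < (N+1)/2} α_k ι(x)^{n − 2k}` for all `x > ½`.
[folklore] -/
theorem exists_ladder_polynomial_eq (hι : ContDiff ℝ (⊤ : ℕ∞) ι)
    (hιeq : ∀ x : ℝ, 1 / 2 ≤ x → ι x = x⁻¹) (n : ℕ) {p : ℝ[X]} {N : ℕ}
    (hdeg : p.natDegree < N) (hN : N ≤ n + 1) :
    ∃ α : ℕ → ℝ, ∀ x : ℝ, 1 / 2 < x →
      ladder ι n (fun y => p.eval y) x = ∑ k ∈ range ((N + 1) / 2), α k * ι x ^ (n - 2 * k) := by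
  classical
  have hexp : (fun y : ℝ => p.eval y) = fun y => ∑ i ∈ range N, p.coeff i * y ^ i := by
    funext y
    exact eval_eq_sum_range' hdeg y
  refine ⟨fun k => p.coeff (2 * k) * ∏ j ∈ range n, (((2 * k : ℕ) : ℝ) - 2 * j - 1), ?_⟩
  intro x hx
  rw [hexp]
  -- ladder of the monomial expansion, term by term
  have hterm : ∀ i ∈ range N, ContDiff ℝ n (fun y : ℝ => p.coeff i * y ^ i) := fun i _ =>
    contDiff_const.mul (contDiff_id.pow i)
  rw [congrFun (ladder_finset_sum hι hterm) x]
  have hmono : ∀ i : ℕ, ladder ι n (fun y : ℝ => p.coeff i * y ^ i) x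
      = p.coeff i * ((∏ k ∈ range n, ((i : ℝ) - 2 * k - 1)) * x ^ ((i : ℤ) - n)) := by
    intro i
    rw [congrFun (ladder_const_mul (ι := ι) n (fun y : ℝ => y ^ i) (p.coeff i)) x,
      ladder_pow_eq hιeq i n x hx]
  simp only [hmono]
  -- odd terms vanish (an odd `i < N ≤ n+1` is `< 2n`, or its coefficient vanishes), even terms
  -- are `ι^{n-2k}`
  rw [sum_range_eq_sum_even N
    (fun i => p.coeff i * ((∏ k ∈ range n, ((i : ℝ) - 2 * k - 1)) * x ^ ((i : ℤ) - n))) ?_]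
  · refine sum_congr rfl fun k hk => ?_
    have hk' : 2 * k ≤ n := by have := Finset.mem_range.1 hk; omega
    rw [hιeq x hx.le, ← zpow_sub_eq_inv_pow x hk']
    ring
  · intro i hi
    by_cases hin : i < 2 * n
    · rw [ladderCoeff_eq_zero_of_odd hi hin]; ring
    · have hcoeff : p.coeff i = 0 := by
        refine coeff_eq_zero_of_natDegree_lt (lt_of_lt_of_le hdeg ?_)
        obtain ⟨j, rfl⟩ := hi
        omega
      rw [hcoeff]; ring

/-- **Ladder of a Taylor sum of degree `≤ n`** (position data): for `d : ℕ → ℝ` and a centre `R`,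
`ladder ι n (y ↦ Σ_{m ≤ n} d_m (y − R)^m) x = Σ_{k ≤ n/2} α_k ι(x)^{n − 2k}` for `x > ½`.
[folklore] -/
theorem exists_ladder_taylorSum_eq (hι : ContDiff ℝ (⊤ : ℕ∞) ι)
    (hιeq : ∀ x : ℝ, 1 / 2 ≤ x → ι x = x⁻¹) (n : ℕ) (d : ℕ → ℝ) (R : ℝ) :
    ∃ α : ℕ → ℝ, ∀ x : ℝ, 1 / 2 < x →
      ladder ι n (fun y => ∑ m ∈ range (n + 1), d m * (y - R) ^ m) x
        = ∑ k ∈ range (n / 2 + 1), α k * ι x ^ (n - 2 * k) := by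
  classical
  set p : ℝ[X] := ∑ m ∈ range (n + 1), C (d m) * (X - C R) ^ m with hp
  have hpeval : (fun y : ℝ => ∑ m ∈ range (n + 1), d m * (y - R) ^ m) = fun y => p.eval y := by
    funext y
    simp [hp, eval_finsetSum]
  have hdeg : p.natDegree < n + 1 := by
    refine Nat.lt_succ_of_le (natDegree_sum_le_of_forall_le _ _ fun m hm => ?_)
    have hm' : m ≤ n := Nat.lt_succ_iff.1 (Finset.mem_range.1 hm)
    calc (C (d m) * (X - C R) ^ m).natDegree ≤ (C (d m)).natDegree + ((X - C R) ^ m).natDegree :=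
          natDegree_mul_le
      _ ≤ 0 + m * (X - C R).natDegree := add_le_add (natDegree_C _).le natDegree_pow_le
      _ ≤ n := by rw [natDegree_X_sub_C]; omega
  have h2 : (n + 1 + 1) / 2 = n / 2 + 1 := by omega
  rw [hpeval, ← h2]
  exact exists_ladder_polynomial_eq hι hιeq n hdeg le_rfl

/-- **Ladder of a Taylor sum of degree `< n`** (velocity data): for `d : ℕ → ℝ` and a centre `R`,
`ladder ι n (y ↦ Σ_{m < n} d_m (y − R)^m) x = Σ_{k < (n+1)/2} β_k ι(x)^{n − 2k}` for `x > ½`.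
[folklore] -/
theorem exists_ladder_taylorSum_lt_eq (hι : ContDiff ℝ (⊤ : ℕ∞) ι)
    (hιeq : ∀ x : ℝ, 1 / 2 ≤ x → ι x = x⁻¹) (n : ℕ) (d : ℕ → ℝ) (R : ℝ) :
    ∃ β : ℕ → ℝ, ∀ x : ℝ, 1 / 2 < x →
      ladder ι n (fun y => ∑ m ∈ range n, d m * (y - R) ^ m) x
        = ∑ k ∈ range ((n + 1) / 2), β k * ι x ^ (n - 2 * k) := by
  classical
  cases n with
  | zero =>
    refine ⟨fun _ => 0, fun x _ => ?_⟩
    simp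
  | succ n =>
    set p : ℝ[X] := ∑ m ∈ range (n + 1), C (d m) * (X - C R) ^ m with hp
    have hpeval : (fun y : ℝ => ∑ m ∈ range (n + 1), d m * (y - R) ^ m) = fun y => p.eval y := by
      funext y
      simp [hp, eval_finsetSum]
    have hdeg : p.natDegree < n + 1 := by
      refine Nat.lt_succ_of_le (natDegree_sum_le_of_forall_le _ _ fun m hm => ?_)
      have hm' : m ≤ n := Nat.lt_succ_iff.1 (Finset.mem_range.1 hm)
      calc (C (d m) * (X - C R) ^ m).natDegree ≤ (C (d m)).natDegree + ((X - C R) ^ m).natDegree :=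
            natDegree_mul_le
        _ ≤ 0 + m * (X - C R).natDegree := add_le_add (natDegree_C _).le natDegree_pow_le
        _ ≤ n := by rw [natDegree_X_sub_C]; omega
    rw [hpeval]
    exact exists_ladder_polynomial_eq hι hιeq (n + 1) hdeg (Nat.le_succ _)

end Literature.Analysis.ODE
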